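import Summits.QuantumFields.YangMills.Theorems.BalabanUVNodesN08AlphaClassI

/-!
# Route «BalabanUVNodes», Track-A DAG node N08 = [Balaban1985UV3] — THE (α) CLAUSE: the GAP-binder DATA row `logZT` (G3D-05, «log Z^{(k)}(T₁^{(k)}, 1)
# is a volume term», (62) p. 271 ∕ (65) p. 273) DISCHARGED BY NAME from the in-edge b9's LOEWNER BOUNDS on the data's own precision form
# `C*Δ_kC` of (63) ([5] Thm 3.11, (3.155)–(3.156)) + two counts

Cell `pub-ymgap`, seat `pub-ymgap-dag-n08-d` gen 3, file 4 (director-ym R134 row «CLASS-I in-edge conclusions at the (α) granularity of `RunAlpha` …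
discharge the species-OK interfaces»; census `HOME/pub-ymgap-dag-n08-b/N08-ALPHA-ROWS.md` 6a78a4e68c218d11 §1 row `logZT (G3D-05)` = «I (b9) + III
(counts cn, cJ); binder `Binders.LogZTExtensiveAsCited` = `Nonempty (LogZTModel …)`; `LogZTModel.logZT_le` PROVED»; §2 «CLASS I rows … the Loewner ∕
covariance bounds inside `norm35` ∕ `logZT` ∕ `h324a` (b9 Thm 3.11, (3.155)–(3.156))»).  `bears_on: R4∕N08`; filed `--supports stmt-QuantumFields-19903
--as helper`.  THEOREMS ONLY (def-free, sorry-free, standard axioms).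

THE ROW.  `UVStability3DInputs.StepAlpha.logZT : LogZTExtensiveAsCited (pieces 𝔠.lane X 𝔖 k) cT aT cn cJT` (= gen 0's `StepDataRows.logZT`) asks for
`LogZTModel` DATA: a dimension, a precision form `Q` with `cT ≤ Q ≤ aT` (Loewner), a Jacobian constant `J`, the IDENTITY `logZT = J + log ∫ e^{−½⟨v,Qv⟩}`
and the counts `dim ≤ cn·|T₁^{(k)}|`, `|J| ≤ cJT·|T₁^{(k)}|`.  But the lane's pieces DEFINE `log Z^{(k)}(T₁^{(k)}, 1)` from the expansion data's OWN
Gaussian presentation (ruling R-FL (ii), `Carriers.StepSeries.logZT := JT + gaussLog QT`, (63) p. 272 «the Gaussian integral determined by the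
positive quadratic form ⟨Ã, C*Δ_kCÃ⟩») — so the identity holds BY `rfl` for the model built on `(dimT, QT, JT)`, and what the row REALLY asks is:
the in-edge b9's Loewner bounds `cT·1 ≤ QT ≤ aT·1` on `C*Δ_kC` ([Balaban1985BackgroundPropagators] Thm 3.11 ∕ (3.155)–(3.156): the covariance `Δ_k` is
bounded above and below) and the two counts (class III: `|T₁^{(k)*}|`-many variables, `O(1)|T₁^{(k)}|` local δ-function constants).
WHAT THIS FILE PROVES: §1 `logZTModel_of_loewner` (the model term), ★ `logZT_of_loewner` (the row verbatim from the four scalar hypotheses), and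
`logZT_le_of_loewner` (the leaf B20 `|log Z^{(k)}(T₁^{(k)},1)| ≤ z·|T₁^{(k)}|` with the O(1) `z` COMPUTED, by `LogZTExtensiveAsCited.logZT_le`);
§2 the sibling binder `norm35` (G3D-04, (35) p. 265 «|log Z⁰(Ω₁,1)∕Z⁰(T₁,1)| ≤ O(1)|Ω₁ᶜ|» asserted in print, `B10Eq35Norm.Norm35Model` = a COMMON-CORE
block presentation of the two precision forms): `gaussLog_reindex` (the Gaussian logarithm is invariant under relabelling the variables —
`MeasureTheory.volume_measurePreserving_piCongrLeft`), ★ `norm35_of_blocks` (the row `StepAlpha.norm35` from the pin's STRUCTURAL identification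
«`Q1 h` and `QT` are, up to relabelling, block forms `[[K, B₁], [B₁ᴴ, D₁]]`, `[[K, B₂], [B₂ᴴ, D₂]]` with a common core `K`» (cell GAPS C-adv9-28 (b)) + b9's
Loewner bounds on the blocks + the two counts against `|Ω₁ᶜ|` = `Zvol`), `norm35_leaf_of_blocks` (the leaf C8 `Norm35` with its O(1) COMPUTED).
HONEST FRAMING: count-neutral; NOT a discharge of N08.  The Loewner bounds are the in-edge b9's conclusion as typed interfaces about the free data
`(𝔖 k).QT ∕ Q1 h`; the block presentation and the counts are what a NODE 00 pin of `𝔖 k` to print's `Z^{(k)}` instantiates — hypotheses here.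
d = 3 lattice gauge theory on finite tori as printed; nothing about d = 4, the continuum, OS axioms, a mass gap or the Clay problem.
-/

noncomputable section

namespace Summit.QuantumFields.YangMills.Theorems.BalabanUVNodesN08AlphaLogZ

open MeasureTheory
open scoped BigOperators Matrix
open Literature.MathematicalPhysics.QuantumFieldTheory.Balaban1983to89
open Literature.MathematicalPhysics.QuantumFieldTheory.Balaban1985CMP102
open Literature.MathematicalPhysics.QuantumFieldTheory.Balaban1985CMP102.Setting
open Literature.MathematicalPhysics.QuantumFieldTheory.Balaban1985CMP102.Binders (LogZTExtensiveAsCited LogZTModel Norm35StepAsCited)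
open Literature.MathematicalPhysics.QuantumFieldTheory.Balaban1983to89.B10Eq35Norm (Norm35Model)
open Summit.QuantumFields.Balaban3D.Carriers.StepSeries (gaussLog)
open Summit.QuantumFields.Balaban3D.Carriers
open Summit.QuantumFields.Balaban3D.Proofs.Inputs
open Summit.QuantumFields.Balaban3D.Proofs.Primitives (AlphaConsts)
open Summit.QuantumFields.Balaban3D.Proofs.GroupModelLieC (lieC)

variable {L : ℕ}

/-! ## §1 G3D-05 `logZT` from b9's Loewner bounds on `C*Δ_kC` -/

section LogZT

variable {S : Scales L} {G : Type} [GaugeGroup G] [MeasurableSpace G] [HaarData G] (𝔊 : GroupModel G) (𝔠 : AlphaConsts L 𝔊.N)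
  (X : ExternalInputs S G) (𝔖 : ∀ k, StepSeries S G ↥(lieC 𝔊) (nblkOf S 𝔠.lane.carrier k) k) (k : ℕ)
  {c a cn cJ : ℝ}
  (hlow : ((𝔖 k).QT - c • (1 : Matrix (Fin (𝔖 k).dimT) (Fin (𝔖 k).dimT) ℝ)).PosSemidef)
  (hup : (a • (1 : Matrix (Fin (𝔖 k).dimT) (Fin (𝔖 k).dimT) ℝ) - (𝔖 k).QT).PosSemidef)
  (hcount : ((𝔖 k).dimT : ℝ) ≤ cn * S.sites k) (hjac : |(𝔖 k).JT| ≤ cJ * S.sites k)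

include hlow hup hcount hjac

/-- **THE `LogZTModel` OF THE LANE'S PIECES FROM b9's LOEWNER BOUNDS + COUNTS**: dimension `dimT`, form `QT`, constant `JT` of the expansion data;
the identity `logZT = JT + log ∫ exp(−½⟨v, QT v⟩)` is the lane's DEFINITION of `log Z^{(k)}(T₁^{(k)}, 1)` (R-FL (ii)), i.e. `rfl`.
[cite: Balaban1985UV3, (62)–(63) pp.271–272; Balaban1985BackgroundPropagators, Thm 3.11 pp.416–417] -/
theorem logZTModel_of_loewner : Nonempty (LogZTModel (pieces 𝔠.lane X 𝔖 k) c a cn cJ) :=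
  ⟨{ dim := (𝔖 k).dimT
     Q := (𝔖 k).QT
     J := (𝔖 k).JT
     lower := hlow
     upper := hup
     logZT_eq := rfl
     count_le := hcount
     jac_le := hjac }⟩

/-- **THE (α) DATA ROW `logZT` (GAP binder G3D-05) FROM b9's LOEWNER BOUNDS ON `C*Δ_kC` + TWO COUNTS** — `StepAlpha.logZT` ∕ `StepDataRows.logZT`
verbatim at any constants `(c, a, cn, cJ)` (the lane's are `𝔠.cT, 𝔠.aT, 𝔠.cn, 𝔠.cJT`). [cite: Balaban1985UV3, (62) p.271 + (65) p.273; Balaban1985BackgroundPropagators, Thm 3.11 pp.416–417] -/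
theorem logZT_of_loewner : LogZTExtensiveAsCited (pieces 𝔠.lane X 𝔖 k) c a cn cJ :=
  logZTModel_of_loewner 𝔊 𝔠 X 𝔖 k hlow hup hcount hjac

/-- **LEAF B20 WITH ITS O(1) COMPUTED**: `|log Z^{(k)}(T₁^{(k)}, 1)| ≤ (cn·(log 2π + max(|log c|, |log a|))∕2 + cJ)·|T₁^{(k)}|` for `0 < c`
(`LogZTExtensiveAsCited.logZT_le` ∘ `logZT_of_loewner`). [cite: Balaban1985UV3, (65) p.273] -/
theorem logZT_le_of_loewner (hc : 0 < c) :
    |(pieces 𝔠.lane X 𝔖 k).logZT| ≤ (cn * ((Real.log (2 * Real.pi) + max |Real.log c| |Real.log a|) / 2) + cJ) * S.sites k :=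
  (logZT_of_loewner 𝔊 𝔠 X 𝔖 k hlow hup hcount hjac).logZT_le hc

end LogZT

/-! ## §2 G3D-04 `norm35` from a common-core block presentation of the two precision forms + b9's Loewner bounds -/

/-- **THE GAUSSIAN LOGARITHM IS INVARIANT UNDER RELABELLING THE VARIABLES**: for a bijection `e : ι ≃ Fin n`,
`log ∫_{ℝⁿ} exp(−½⟨v, (reindex e e M)v⟩) dv = log ∫_{ℝ^ι} exp(−½⟨w, Mw⟩) dw` (the coordinate permutation preserves Lebesgue measure,
`MeasureTheory.volume_measurePreserving_piCongrLeft`). [folklore] -/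
theorem gaussLog_reindex {ι : Type} [Fintype ι] {n : ℕ} (e : ι ≃ Fin n) (M : Matrix ι ι ℝ) :
    gaussLog (Matrix.reindex e e M) = Real.log (∫ w : ι → ℝ, Real.exp (-(1 / 2 : ℝ) * (w ⬝ᵥ M *ᵥ w))) := by
  unfold gaussLog
  congr 1
  have hΦ := (MeasureTheory.volume_measurePreserving_piCongrLeft (fun _ : Fin n => ℝ) e).symm
  rw [← hΦ.integral_comp']
  refine integral_congr_ae (Filter.Eventually.of_forall fun v => ?_)
  have hv : ((MeasurableEquiv.piCongrLeft (fun _ : Fin n => ℝ) e).symm v) = v ∘ e := by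
    funext i
    simp [MeasurableEquiv.piCongrLeft]
  dsimp only
  rw [hv]
  congr 2
  rw [Matrix.reindex_apply, Matrix.submatrix_mulVec_equiv, Equiv.symm_symm, dotProduct_comm, comp_equiv_symm_dotProduct,
    dotProduct_comm]

section Norm35

variable {S : Scales L} {G : Type} [GaugeGroup G] [MeasurableSpace G] [HaarData G] (𝔊 : GroupModel G) (𝔠 : AlphaConsts L 𝔊.N)
  (X : ExternalInputs S G) (𝔖 : ∀ k, StepSeries S G ↥(lieC 𝔊) (nblkOf S 𝔠.lane.carrier k) k) (k : ℕ)
  {c a cv cJ : ℝ}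
  (r s t : Hist S.P (k + 1) → ℕ)
  (K : (h : Hist S.P (k + 1)) → Matrix (Fin (r h)) (Fin (r h)) ℝ)
  (B₁ : (h : Hist S.P (k + 1)) → Matrix (Fin (r h)) (Fin (s h)) ℝ) (D₁ : (h : Hist S.P (k + 1)) → Matrix (Fin (s h)) (Fin (s h)) ℝ)
  (B₂ : (h : Hist S.P (k + 1)) → Matrix (Fin (r h)) (Fin (t h)) ℝ) (D₂ : (h : Hist S.P (k + 1)) → Matrix (Fin (t h)) (Fin (t h)) ℝ)
  (e₁ : (h : Hist S.P (k + 1)) → Fin (r h) ⊕ Fin (s h) ≃ Fin ((𝔖 k).dimZ h))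
  (e₂ : (h : Hist S.P (k + 1)) → Fin (r h) ⊕ Fin (t h) ≃ Fin (𝔖 k).dimT)
  (hQ1 : ∀ h, (𝔖 k).Q1 h = Matrix.reindex (e₁ h) (e₁ h) (Matrix.fromBlocks (K h) (B₁ h) (B₁ h)ᴴ (D₁ h)))
  (hQT : ∀ h, (𝔖 k).QT = Matrix.reindex (e₂ h) (e₂ h) (Matrix.fromBlocks (K h) (B₂ h) (B₂ h)ᴴ (D₂ h)))
  (hlow₁ : ∀ h, (Matrix.fromBlocks (K h) (B₁ h) (B₁ h)ᴴ (D₁ h) -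
    c • (1 : Matrix (Fin (r h) ⊕ Fin (s h)) (Fin (r h) ⊕ Fin (s h)) ℝ)).PosSemidef)
  (hup₁ : ∀ h, (a • (1 : Matrix (Fin (s h)) (Fin (s h)) ℝ) - D₁ h).PosSemidef)
  (hlow₂ : ∀ h, (Matrix.fromBlocks (K h) (B₂ h) (B₂ h)ᴴ (D₂ h) -
    c • (1 : Matrix (Fin (r h) ⊕ Fin (t h)) (Fin (r h) ⊕ Fin (t h)) ℝ)).PosSemidef)
  (hup₂ : ∀ h, (a • (1 : Matrix (Fin (t h)) (Fin (t h)) ℝ) - D₂ h).PosSemidef)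
  (hcount : ∀ h, ((s h : ℝ) + t h) ≤ cv * (pieces 𝔠.lane X 𝔖 k).Zvol h)
  (hjac : ∀ h, |(𝔖 k).J1 h - (𝔖 k).JT| ≤ cJ * (pieces 𝔠.lane X 𝔖 k).Zvol h)

include hQ1 hQT hlow₁ hup₁ hlow₂ hup₂ hcount hjac

/-- **THE (α) DATA ROW `norm35` (GAP binder G3D-04, (35) p. 265) FROM THE COMMON-CORE BLOCK PRESENTATION + b9's LOEWNER BOUNDS + COUNTS**:
for every history the `Norm35Model` of the lane's pieces is ASSEMBLED — the two Gaussian presentations `log Z^{(k)}(B(Λ_{k+1}), 1) = J1 + log∫`,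
`log Z^{(k)}(T₁^{(k)}, 1) = JT + log∫` are the lane's DEFINITIONS (R-FL (ii)), carried to the block variables by `gaussLog_reindex`; the form
bounds `c ≤ · `, `D ≤ a` are the in-edge b9's ([5] Thm 3.11); the identification of `Q1 h`, `QT` with block forms sharing the core `K` and the
counts `s + t ≤ cv·|Ω₁ᶜ|`, `|J1 − JT| ≤ cJ·|Ω₁ᶜ|` are the pin's structural content (cell GAPS C-adv9-28 (b)). [cite: Balaban1985UV3, (35) p.265 + (61)–(63) pp.271–272; Balaban1985BackgroundPropagators, Thm 3.11 pp.416–417] -/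
theorem norm35_of_blocks : Norm35StepAsCited (pieces 𝔠.lane X 𝔖 k) c a cv cJ := fun h =>
  ⟨{ r := r h, s := s h, t := t h, K := K h, B₁ := B₁ h, D₁ := D₁ h, B₂ := B₂ h, D₂ := D₂ h
     J₁ := (𝔖 k).J1 h, J₂ := (𝔖 k).JT
     lower₁ := hlow₁ h, upper₁ := hup₁ h, lower₂ := hlow₂ h, upper₂ := hup₂ h
     logZ1_eq := by
       show (𝔖 k).J1 h + gaussLog ((𝔖 k).Q1 h) = _
       rw [hQ1 h, gaussLog_reindex]
     logZT_eq := by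
       show (𝔖 k).JT + gaussLog (𝔖 k).QT = _
       rw [hQT h, gaussLog_reindex]
     count_le := hcount h
     jac_le := hjac h }⟩

/-- **LEAF C8 WITH ITS O(1) COMPUTED**: `Norm35 (pieces …) (cv·(log 2π + max(|log c|, |log a|))∕2 + cJ)` for `0 < c`
(`Norm35StepAsCited.norm35` = `B10Eq35Norm.norm35_of_model` BY NAME). [cite: Balaban1985UV3, (35) p.265] -/
theorem norm35_leaf_of_blocks (hc : 0 < c) :
    B10SectAGathering.Norm35 (pieces 𝔠.lane X 𝔖 k) (cv * ((Real.log (2 * Real.pi) + max |Real.log c| |Real.log a|) / 2) + cJ) :=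
  (norm35_of_blocks 𝔊 𝔠 X 𝔖 k r s t K B₁ D₁ B₂ D₂ e₁ e₂ hQ1 hQT hlow₁ hup₁ hlow₂ hup₂ hcount hjac).norm35 hc

end Norm35

end Summit.QuantumFields.YangMills.Theorems.BalabanUVNodesN08AlphaLogZ

end
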